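import Literature.Analysis.FluidPDE.PalasekObukhov.ShellEmbedding

/-!
# Palasek 2026, §1.3.2: why the viscous tower is forced — the dissipation window of an unforced mode

S. Palasek, *Finite-time blow-up in an elementary model of the 3D Navier–Stokes equations*,
arXiv:2605.13827 (2026) [Palasek2026ElementaryModel], §1.3.2 "Viscous case", p. 6, second paragraph,
with Remark 1.4 (p. 4: "The inclusion of an external force is necessary for blow-up in this model, as
shown in [looi]"). The printed passage:

> "One encounters another constraint in the viscous setting which is not connected to energy
> criticality, but is nonetheless unavoidable as recently shown by Looi [looi]. Consider (approx)
> [`X_k' ≈ (N_{k-1}^α X_{k-1} - νN_k²)X_k`] with positive initial data. Then growth or decay of `X_k(t)`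
> is governed by the sign of `-νN_k²t + N_{k-1}^α ∫₀ᵗ X_{k-1}`. By Cauchy–Schwarz and the energy
> equality, the second term is `O(N_{k-1}^{α-1})`, so growth is obstructed when `α < 3`. In essence,
> each mode `X_{k-1}` (for `k` large) is only required to be active over the short time span `T_k`
> during which it causes growth of `X_k` (see above), but, if arising from the initial data, is forced
> to be active for the full solution lifespan. To avoid this issue, we use a small force to deactivate
> the dissipation of each mode for times prior to its activation."

This file makes that paragraph exact for the UNFORCED viscous Obukhov model (l2_obukhov)
(`obukhovRHS ν α N X 0 k`, file `PalasekObukhovBlowup.lean`), statements first and everything proved: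

* `le_max_mul_exp_of_hasDerivWithinAt` — the comparison behind "(approx) governs growth or decay":
  a scalar `u` with `u' = a(t)u - p(t)`, `p ≥ 0` (the dropped high-high→low term `-N_k^αX_{k+1}²` has a
  sign, whatever the sign of `X_k`) stays below `max{u(0), 0}·e^{B(t)}` for ANY `B` with `B(0) = 0` and
  `B' ≥ a`; no positivity hypothesis on the mode is needed (positivity of `X_k` is NOT preserved by
  the unforced model in general — the back-reaction can drive a mode through zero).
* `unforced_mode_le_exp` — "by Cauchy–Schwarz and the energy equality": given ANY dissipation budget
  for the pumping mode (a function `E ≥ 0` with `E' ≤ -νN_{k-1}²X_{k-1}²` on `[0,T)` — the energy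
  `e(t) = ½ΣX_j²` of (2.6) for the full system "above a certain Onsager-like regularity", or the
  truncated energy `truncEnergy` below, exactly), every mode `k ≥ 1` of an unforced solution obeys,
  for every `λ > 0`,
  `X_k(t) ≤ max{X_k(0),0}·exp(λ(E(0) - E(t)) + (N_{k-1}^{2α-2}/(4λν) - νN_k²)t)`.
  (Pointwise AM–GM `N^αX ≤ λνN²X² + N^{2α-2}/(4λν)` replaces the printed Cauchy–Schwarz; optimising
  `λ` at fixed `t` returns EXACTLY the printed bound, `unforced_mode_le_exp_sqrt`:
  `X_k(t) ≤ max{X_k(0),0}·exp(-νN_k²t + N_{k-1}^{α-1}√(E(0)t/ν))` — "the second term is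
  `O(N_{k-1}^{α-1})`".)
* `unforced_mode_le_of_window_le` — "growth is obstructed": NO NET GROWTH after the initial layer
  `t ≥ t⋆_k := N_{k-1}^{2α-2}E(0)/(ν³N_k⁴)`, i.e. `X_k(t) ≤ max{X_k(0), 0}` there; and
  `unforced_mode_amplification_le` — the total amplification over the whole lifespan is at most
  `exp(N_{k-1}^{2α-2}E(0)/(4ν²N_k²))` ("the best one could hope for would be a norm inflation-type
  result", §1.3.1).
* `truncated_unforced_mode_le_exp` / `…_of_window_le` / `…_amplification_le` — the same for the
  Galerkin truncations (modes `0..M`, `X_{M+1} ≡ 0`, no force), where the budget IS the truncated energy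
  `truncEnergy M X` by the exact finite-mode balance `hasDerivWithinAt_halfSumSq` of
  `ShellEmbedding.lean`; all constants uniform in `M`.
* "when `α < 3`": for increasing scales `t⋆_k ≤ N_{k-1}^{2α-6}E(0)/ν³` (`window_le_rpow_of_le`), and in
  Palasek's scales `N_k = N₀^{b^k}` this tends to `0` along the levels when `α < 3`
  (`tendsto_scale_rpow_atTop_nhds_zero`): a level seeded in the datum can only do its net growing
  inside `[0, N_{k-1}^{2α-6}E(0)/ν³]`, simultaneously for all large `k` — incompatible with the
  ordered activation times `T_k` of the cascade of §1.3.1 (that last clause is the printed heuristic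
  and is not typed). How Theorem 1.3 evades it is ALREADY in the tree: the force
  `g_k = (1-ρ_k)νN_k²x_k` (`forceTerm`, `PalasekObukhovBlowupProof.lean`) cancels the `-νN_k²` of `a(t)`
  before the activation time `t_k`, so the constructed tower solves `x_k' = -ρ_kνN_k²x_k + …`
  (`IsTowerSolution.hasDeriv_forced`, `TowerEnvelope.lean`): no dissipation, hence no window, before
  activation — "the force in a sense sets the stage for the blow-up, but has no role in the growth
  itself".

WHAT THIS IS NOT. Not Navier–Stokes: an ODE shell model. Not Looi's theorem ([looi] = S. Looi, "to
appear, 2026": global regularity of the UNFORCED viscous model in dimension three) — no statement of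
it is in print, nothing of it is vendored here; this file proves only the elementary mechanism the
source prints in §1.3.2, for every solution with a dissipation budget and for every truncation. No
named facts (`def … : Prop`); the one definition (`truncEnergy`) has a body.
-/

open Set Filter Topology Finset

noncomputable section

namespace Literature.Analysis.FluidPDE

namespace PalasekObukhov

/-! ### The comparison behind "(approx) governs growth or decay" -/

/-- **One-sided linear comparison, no sign condition on the unknown.** If `u' = a(t)u - p(t)` within
`[0, T)` with `p ≥ 0`, and `B` is any function with `B(0) = 0` and `B' = β ≥ a` within `[0, T)`, then
`u(t) ≤ max{u(0), 0}·e^{B(t)}` on `[0, T)`. (For the Obukhov mode `k`: `a = -νN_k² + N_{k-1}^αX_{k-1}`,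
`p = N_k^αX_{k+1}² ≥ 0` — the printed approximation (approx) `X_k' ≈ (N_{k-1}^αX_{k-1} - νN_k²)X_k` is an
UPPER solution whatever the sign of `X_k`.) Proof: Mathlib's fencing theorem against the strict
supersolutions `(m + ε)e^{B(t) + εt}`, `ε ↓ 0`.
[cite: Palasek2026ElementaryModel, §1.3.2 p. 6 ((approx) and "growth or decay of X_k(t) is governed by the sign of -νN_k²t + N_{k-1}^α∫₀ᵗX_{k-1}")] -/
theorem le_max_mul_exp_of_hasDerivWithinAt {u a p B β : ℝ → ℝ} {T : ℝ}
    (hu : ∀ t ∈ Ico 0 T, HasDerivWithinAt u (a t * u t - p t) (Ico 0 T) t)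
    (hp : ∀ t ∈ Ico 0 T, 0 ≤ p t)
    (hB : ∀ t ∈ Ico 0 T, HasDerivWithinAt B (β t) (Ico 0 T) t) (hB0 : B 0 = 0)
    (haβ : ∀ t ∈ Ico 0 T, a t ≤ β t) :
    ∀ t ∈ Ico 0 T, u t ≤ max (u 0) 0 * Real.exp (B t) := by
  intro t ht
  have hsub : Icc 0 t ⊆ Ico 0 T := fun s hs => ⟨hs.1, hs.2.trans_lt ht.2⟩
  have hIco : ∀ s ∈ Ico 0 t, s ∈ Ico 0 T := fun s hs => ⟨hs.1, hs.2.trans ht.2⟩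
  have hcu : ContinuousOn u (Icc 0 t) := fun s hs =>
    ((hu s (hsub hs)).continuousWithinAt).mono hsub
  have hcB : ContinuousOn B (Icc 0 t) := fun s hs =>
    ((hB s (hsub hs)).continuousWithinAt).mono hsub
  have hu' : ∀ s ∈ Ico 0 t, HasDerivWithinAt u (a s * u s - p s) (Ici s) s := fun s hs =>
    (hu s (hIco s hs)).mono_of_mem_nhdsWithin (Ico_mem_nhdsGE_of_mem (hIco s hs))
  have hB' : ∀ s ∈ Ico 0 t, HasDerivWithinAt B (β s) (Ici s) s := fun s hs =>
    (hB s (hIco s hs)).mono_of_mem_nhdsWithin (Ico_mem_nhdsGE_of_mem (hIco s hs))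
  set m : ℝ := max (u 0) 0 with hm
  have hm0 : 0 ≤ m := le_max_right _ _
  have hum : u 0 ≤ m := le_max_left _ _
  -- the strict fences `(m + ε)·exp(B s + ε s)`
  have hfence : ∀ ε : ℝ, 0 < ε → u t ≤ (m + ε) * Real.exp (B t + ε * t) := by
    intro ε hε
    have key := image_le_of_deriv_right_lt_deriv_boundary' (f := u)
      (f' := fun s => a s * u s - p s) (a := 0) (b := t) hcu hu'
      (B := fun s => (m + ε) * Real.exp (B s + ε * s))
      (B' := fun s => (m + ε) * Real.exp (B s + ε * s) * (β s + ε)) ?_ ?_ ?_ ?_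
    · exact key (right_mem_Icc.2 ht.1)
    · show u 0 ≤ (m + ε) * Real.exp (B 0 + ε * 0)
      rw [hB0, mul_zero, add_zero, Real.exp_zero, mul_one]
      linarith
    · exact continuousOn_const.mul ((hcB.add (continuousOn_const.mul continuousOn_id)).rexp)
    · intro s hs
      have h1 : HasDerivWithinAt (fun r => B r + ε * r) (β s + ε * 1) (Ici s) s :=
        (hB' s hs).add ((hasDerivWithinAt_id s (Ici s)).const_mul ε)
      have h2 : HasDerivWithinAt (fun r => (m + ε) * Real.exp (B r + ε * r))
          ((m + ε) * (Real.exp (B s + ε * s) * (β s + ε * 1))) (Ici s) s :=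
        (h1.exp).const_mul (m + ε)
      show HasDerivWithinAt (fun r => (m + ε) * Real.exp (B r + ε * r))
        ((m + ε) * Real.exp (B s + ε * s) * (β s + ε)) (Ici s) s
      convert h2 using 1
      ring
    · intro s hs hcontact
      show a s * u s - p s < (m + ε) * Real.exp (B s + ε * s) * (β s + ε)
      have hF : 0 < (m + ε) * Real.exp (B s + ε * s) := mul_pos (by linarith) (Real.exp_pos _)
      have hps := hp s (hIco s hs)
      have hab := haβ s (hIco s hs)
      have hc : u s = (m + ε) * Real.exp (B s + ε * s) := hcontact
      rw [hc]
      nlinarith [mul_pos hF hε, mul_nonneg hF.le (sub_nonneg.2 hab)]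
  -- let `ε ↓ 0`
  have hlim : Tendsto (fun ε : ℝ => (m + ε) * Real.exp (B t + ε * t)) (𝓝[>] 0)
      (𝓝 (m * Real.exp (B t))) := by
    have hc : Continuous fun ε : ℝ => (m + ε) * Real.exp (B t + ε * t) := by fun_prop
    have h0 := hc.tendsto 0
    simp only [add_zero, zero_mul] at h0
    exact h0.mono_left nhdsWithin_le_nhds
  exact ge_of_tendsto hlim (eventually_nhdsWithin_of_forall fun ε hε => hfence ε hε)

/-! ### The dissipation window of an unforced mode (§1.3.2), for any dissipation budget -/

section Window

variable {ν α : ℝ} {N : ℕ → ℝ} {X : ℕ → ℝ → ℝ} {T : ℝ}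

/-- Pointwise AM–GM in the form used below: `N^α X ≤ λνN² X² + N^{2α-2}/(4λν)` for `λ, ν, N > 0` —
the integral-free substitute for "by Cauchy–Schwarz". [cite: Palasek2026ElementaryModel, §1.3.2 p. 6 ("By Cauchy–Schwarz and the energy equality")] -/
theorem rpow_mul_le_amgm {lam ν n : ℝ} (hlam : 0 < lam) (hν : 0 < ν) (hn : 0 < n) (α x : ℝ) :
    n ^ α * x ≤ lam * ν * n ^ 2 * x ^ 2 + n ^ (2 * α - 2) / (4 * lam * ν) := by
  have hq : 0 < lam * ν * n ^ 2 := by positivity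
  have hpow : n ^ (2 * α - 2) = (n ^ α) ^ 2 / n ^ 2 := by
    rw [Real.rpow_sub hn, show (2 : ℝ) * α = α * 2 by ring, Real.rpow_mul hn.le, Real.rpow_two,
      Real.rpow_two]
  have hc : n ^ (2 * α - 2) / (4 * lam * ν) = (n ^ α) ^ 2 / (4 * (lam * ν * n ^ 2)) := by
    rw [hpow]
    field_simp
  rw [hc]
  have h0 : 0 ≤ lam * ν * n ^ 2 * (x - n ^ α / (2 * (lam * ν * n ^ 2))) ^ 2 :=
    mul_nonneg hq.le (sq_nonneg _)
  have hexp : lam * ν * n ^ 2 * (x - n ^ α / (2 * (lam * ν * n ^ 2))) ^ 2 =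
      lam * ν * n ^ 2 * x ^ 2 - n ^ α * x + (n ^ α) ^ 2 / (4 * (lam * ν * n ^ 2)) := by
    field_simp
    ring
  linarith [h0, hexp]

/-- **The `λ`-family of exponential bounds for an unforced mode ("growth or decay … governed by the sign
of `-νN_k²t + N_{k-1}^α∫₀ᵗX_{k-1}`", made exact).** Let mode `k ≥ 1` of `X` solve the UNFORCED model
(l2_obukhov) (`f_k = 0`) within `[0, T)`, `ν > 0`, all scales positive, and let `E` be a dissipation
budget for the pumping mode: `E' ≤ -νN_{k-1}²X_{k-1}²` within `[0, T)` (the energy of (2.6), or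
`truncEnergy` below). Then for every `λ > 0` and `t ∈ [0, T)`,
`X_k(t) ≤ max{X_k(0), 0}·exp(λ(E(0) - E(t)) + (N_{k-1}^{2α-2}/(4λν) - νN_k²)t)`.
[cite: Palasek2026ElementaryModel, §1.3.2 p. 6] -/
theorem unforced_mode_le_exp (hν : 0 < ν) (hN : ∀ j, 0 < N j) {k : ℕ} (hk : 1 ≤ k)
    (hXk : ∀ t ∈ Ico 0 T,
      HasDerivWithinAt (X k) (obukhovRHS ν α N (fun j => X j t) 0 k) (Ico 0 T) t)
    {E E' : ℝ → ℝ} (hE : ∀ t ∈ Ico 0 T, HasDerivWithinAt E (E' t) (Ico 0 T) t)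
    (hE' : ∀ t ∈ Ico 0 T, E' t ≤ -(ν * N (k - 1) ^ 2 * X (k - 1) t ^ 2))
    {lam : ℝ} (hlam : 0 < lam) :
    ∀ t ∈ Ico 0 T, X k t ≤ max (X k 0) 0 *
      Real.exp (lam * (E 0 - E t) + (N (k - 1) ^ (2 * α - 2) / (4 * lam * ν) - ν * N k ^ 2) * t) := by
  set c : ℝ := N (k - 1) ^ (2 * α - 2) / (4 * lam * ν) with hc
  have hk0 : k ≠ 0 := by omega
  have hode : ∀ t ∈ Ico 0 T, HasDerivWithinAt (X k)
      ((-ν * N k ^ 2 + N (k - 1) ^ α * X (k - 1) t) * X k t - N k ^ α * X (k + 1) t ^ 2)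
      (Ico 0 T) t := by
    intro t ht
    have h := hXk t ht
    simp only [obukhovRHS, hk0, ↓reduceIte, add_zero] at h
    convert h using 1
    ring
  refine le_max_mul_exp_of_hasDerivWithinAt
    (a := fun t => -ν * N k ^ 2 + N (k - 1) ^ α * X (k - 1) t)
    (p := fun t => N k ^ α * X (k + 1) t ^ 2)
    (B := fun t => lam * (E 0 - E t) + (c - ν * N k ^ 2) * t)
    (β := fun t => -lam * E' t + (c - ν * N k ^ 2)) hode ?_ ?_ ?_ ?_
  · intro t _
    exact mul_nonneg (Real.rpow_nonneg (hN k).le _) (sq_nonneg _)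
  · intro t ht
    have h1 : HasDerivWithinAt (fun s => lam * (E 0 - E s)) (lam * -E' t) (Ico 0 T) t :=
      ((hE t ht).const_sub (E 0)).const_mul lam
    have h2 : HasDerivWithinAt (fun s => (c - ν * N k ^ 2) * s) ((c - ν * N k ^ 2) * 1)
        (Ico 0 T) t :=
      (hasDerivWithinAt_id t (Ico 0 T)).const_mul (c - ν * N k ^ 2)
    have h3 : HasDerivWithinAt (fun s => lam * (E 0 - E s) + (c - ν * N k ^ 2) * s)
        (lam * -E' t + (c - ν * N k ^ 2) * 1) (Ico 0 T) t := h1.add h2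
    show HasDerivWithinAt (fun s => lam * (E 0 - E s) + (c - ν * N k ^ 2) * s)
      (-lam * E' t + (c - ν * N k ^ 2)) (Ico 0 T) t
    refine h3.congr_deriv ?_
    ring
  · simp
  · intro t ht
    show -ν * N k ^ 2 + N (k - 1) ^ α * X (k - 1) t ≤ -lam * E' t + (c - ν * N k ^ 2)
    have hkey := rpow_mul_le_amgm hlam hν (hN (k - 1)) α (X (k - 1) t)
    have h3 : lam * E' t ≤ lam * -(ν * N (k - 1) ^ 2 * X (k - 1) t ^ 2) :=
      mul_le_mul_of_nonneg_left (hE' t ht) hlam.le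
    rw [← hc] at hkey
    nlinarith [hkey, h3]

/-- **Total amplification of an unforced mode is at most `exp(N_{k-1}^{2α-2}E(0)/(4ν²N_k²))`** over the
whole of `[0, T)` (the choice `λ = N_{k-1}^{2α-2}/(4ν²N_k²)` kills the linear-in-`t` term; needs the
budget `E ≥ 0`): a level present in the datum and never forced cannot be amplified by more than this
factor, however long the solution lives ("the best one could hope for would be a norm inflation-type
result, not a genuine loss of regularity", §1.3.1 p. 5, here for the viscous obstruction of §1.3.2).
[cite: Palasek2026ElementaryModel, §1.3.2 p. 6; §1.3.1 p. 5] -/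
theorem unforced_mode_amplification_le (hν : 0 < ν) (hN : ∀ j, 0 < N j) {k : ℕ} (hk : 1 ≤ k)
    (hXk : ∀ t ∈ Ico 0 T,
      HasDerivWithinAt (X k) (obukhovRHS ν α N (fun j => X j t) 0 k) (Ico 0 T) t)
    {E E' : ℝ → ℝ} (hE : ∀ t ∈ Ico 0 T, HasDerivWithinAt E (E' t) (Ico 0 T) t)
    (hE' : ∀ t ∈ Ico 0 T, E' t ≤ -(ν * N (k - 1) ^ 2 * X (k - 1) t ^ 2))
    (hEnn : ∀ t ∈ Ico 0 T, 0 ≤ E t) :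
    ∀ t ∈ Ico 0 T, X k t ≤ max (X k 0) 0 *
      Real.exp (N (k - 1) ^ (2 * α - 2) * E 0 / (4 * ν ^ 2 * N k ^ 2)) := by
  intro t ht
  have hNk : 0 < N k := hN k
  set P : ℝ := N (k - 1) ^ (2 * α - 2) with hP_def
  have hP : 0 < P := Real.rpow_pos_of_pos (hN (k - 1)) _
  set lam : ℝ := P / (4 * ν ^ 2 * N k ^ 2) with hlam_def
  have hlam : 0 < lam := by positivity
  have h := unforced_mode_le_exp hν hN hk hXk hE hE' hlam t ht
  have hcoef : P / (4 * lam * ν) - ν * N k ^ 2 = 0 := by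
    have hP0 : P ≠ 0 := hP.ne'
    rw [hlam_def]
    field_simp
    ring
  rw [hcoef, zero_mul, add_zero] at h
  refine h.trans (mul_le_mul_of_nonneg_left (Real.exp_le_exp.2 ?_) (le_max_right _ _))
  have hEt := hEnn t ht
  have : lam * (E 0 - E t) ≤ lam * E 0 := by nlinarith
  refine this.trans (le_of_eq ?_)
  rw [hlam_def]
  ring

/-- **"Growth is obstructed": the dissipation window.** After the initial layer
`t ≥ t⋆_k := N_{k-1}^{2α-2}E(0)/(ν³N_k⁴)` an unforced mode has made NO net growth:
`X_k(t) ≤ max{X_k(0), 0}` (choice `λ = N_{k-1}^{2α-2}/(2ν²N_k²)`, for which the exponent is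
`λ(E(0)-E(t)) - ½νN_k²t ≤ N_{k-1}^{2α-2}E(0)/(2ν²N_k²) - ½νN_k²t ≤ 0`). This is the printed sign
criterion: `-νN_k²t + N_{k-1}^α∫₀ᵗX_{k-1} ≤ -νN_k²t + N_{k-1}^{α-1}√(E(0)t/ν) ≤ 0` exactly when
`t ≥ t⋆_k`. [cite: Palasek2026ElementaryModel, §1.3.2 p. 6 ("growth is obstructed")] -/
theorem unforced_mode_le_of_window_le (hν : 0 < ν) (hN : ∀ j, 0 < N j) {k : ℕ} (hk : 1 ≤ k)
    (hXk : ∀ t ∈ Ico 0 T,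
      HasDerivWithinAt (X k) (obukhovRHS ν α N (fun j => X j t) 0 k) (Ico 0 T) t)
    {E E' : ℝ → ℝ} (hE : ∀ t ∈ Ico 0 T, HasDerivWithinAt E (E' t) (Ico 0 T) t)
    (hE' : ∀ t ∈ Ico 0 T, E' t ≤ -(ν * N (k - 1) ^ 2 * X (k - 1) t ^ 2))
    (hEnn : ∀ t ∈ Ico 0 T, 0 ≤ E t) {t : ℝ} (ht : t ∈ Ico 0 T)
    (hwin : N (k - 1) ^ (2 * α - 2) * E 0 / (ν ^ 3 * N k ^ 4) ≤ t) :
    X k t ≤ max (X k 0) 0 := by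
  have hNk : 0 < N k := hN k
  set P : ℝ := N (k - 1) ^ (2 * α - 2) with hP_def
  have hP : 0 < P := Real.rpow_pos_of_pos (hN (k - 1)) _
  set lam : ℝ := P / (2 * ν ^ 2 * N k ^ 2) with hlam_def
  have hlam : 0 < lam := by positivity
  have h := unforced_mode_le_exp hν hN hk hXk hE hE' hlam t ht
  have hcoef : P / (4 * lam * ν) - ν * N k ^ 2 = -(ν * N k ^ 2 / 2) := by
    have hP0 : P ≠ 0 := hP.ne'
    rw [hlam_def]
    field_simp
    ring
  rw [hcoef] at h
  have hexp : lam * (E 0 - E t) + -(ν * N k ^ 2 / 2) * t ≤ 0 := by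
    have hEt := hEnn t ht
    have h1 : lam * (E 0 - E t) ≤ lam * E 0 := by nlinarith
    -- `λE(0) = N^{2α-2}E(0)/(2ν²N_k²) ≤ ½νN_k² t` iff `t ≥ t⋆_k`
    have h2 : lam * E 0 ≤ ν * N k ^ 2 / 2 * t := by
      rw [hlam_def]
      have hν3 : 0 < ν ^ 3 * N k ^ 4 := by positivity
      have := (div_le_iff₀ hν3).1 hwin
      rw [div_mul_eq_mul_div, div_le_iff₀ (by positivity : (0 : ℝ) < 2 * ν ^ 2 * N k ^ 2)]
      nlinarith [this, hν, hNk]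
    linarith
  calc X k t ≤ max (X k 0) 0 * Real.exp (lam * (E 0 - E t) + -(ν * N k ^ 2 / 2) * t) := h
    _ ≤ max (X k 0) 0 * 1 :=
      mul_le_mul_of_nonneg_left (Real.exp_le_one_iff.2 hexp) (le_max_right _ _)
    _ = max (X k 0) 0 := mul_one _

/-- **The printed form: "the second term is `O(N_{k-1}^{α-1})`".** Optimising `λ` at fixed `t > 0`
(`λ = N_{k-1}^{α-1}√(tE(0)/ν)/(2E(0))`, `E(0) > 0`) gives exactly the Cauchy–Schwarz bound of the
source, `N_{k-1}^α∫₀ᵗX_{k-1} ≤ N_{k-1}^{α-1}√(E(0)t/ν)`, inside the exponent: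
`X_k(t) ≤ max{X_k(0), 0}·exp(-νN_k²t + N_{k-1}^{α-1}√(tE(0)/ν))`.
[cite: Palasek2026ElementaryModel, §1.3.2 p. 6 ("By Cauchy–Schwarz and the energy equality, the second term is O(N_{k-1}^{α-1})")] -/
theorem unforced_mode_le_exp_sqrt (hν : 0 < ν) (hN : ∀ j, 0 < N j) {k : ℕ} (hk : 1 ≤ k)
    (hXk : ∀ t ∈ Ico 0 T,
      HasDerivWithinAt (X k) (obukhovRHS ν α N (fun j => X j t) 0 k) (Ico 0 T) t)
    {E E' : ℝ → ℝ} (hE : ∀ t ∈ Ico 0 T, HasDerivWithinAt E (E' t) (Ico 0 T) t)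
    (hE' : ∀ t ∈ Ico 0 T, E' t ≤ -(ν * N (k - 1) ^ 2 * X (k - 1) t ^ 2))
    (hEnn : ∀ t ∈ Ico 0 T, 0 ≤ E t) (hE0 : 0 < E 0) {t : ℝ} (ht : t ∈ Ico 0 T) (ht0 : 0 < t) :
    X k t ≤ max (X k 0) 0 *
      Real.exp (-(ν * N k ^ 2 * t) + N (k - 1) ^ (α - 1) * Real.sqrt (t * E 0 / ν)) := by
  have hNk : 0 < N k := hN k
  have hn : 0 < N (k - 1) := hN (k - 1)
  have hP : 0 < N (k - 1) ^ (α - 1) := Real.rpow_pos_of_pos hn _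
  set r : ℝ := Real.sqrt (t * E 0 / ν) with hr_def
  have hr2 : r ^ 2 = t * E 0 / ν := by
    rw [hr_def, Real.sq_sqrt]
    positivity
  have hr : 0 < r := by
    rw [hr_def]
    exact Real.sqrt_pos.2 (by positivity)
  set lam : ℝ := N (k - 1) ^ (α - 1) * r / (2 * E 0) with hlam_def
  have hlam : 0 < lam := by positivity
  have h := unforced_mode_le_exp hν hN hk hXk hE hE' hlam t ht
  refine h.trans (mul_le_mul_of_nonneg_left (Real.exp_le_exp.2 ?_) (le_max_right _ _))
  have hpow : N (k - 1) ^ (2 * α - 2) = (N (k - 1) ^ (α - 1)) ^ 2 := by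
    rw [show (2 : ℝ) * α - 2 = (α - 1) * 2 by ring, Real.rpow_mul hn.le, Real.rpow_two]
  have hEt := hEnn t ht
  have h1 : lam * (E 0 - E t) ≤ lam * E 0 := by nlinarith
  -- `λE(0) = ½N^{α-1}r` and `N^{2α-2}t/(4λν) = ½N^{α-1}r` (using `r² = tE(0)/ν`)
  have h2 : lam * E 0 = N (k - 1) ^ (α - 1) * r / 2 := by
    rw [hlam_def]
    field_simp
  have htE : t * E 0 = ν * r ^ 2 := by
    rw [hr2]
    field_simp
  have h3 : N (k - 1) ^ (2 * α - 2) / (4 * lam * ν) * t = N (k - 1) ^ (α - 1) * r / 2 := by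
    rw [hpow, hlam_def]
    field_simp
    nlinarith [htE, hP, hr]
  have h4 : (N (k - 1) ^ (2 * α - 2) / (4 * lam * ν) - ν * N k ^ 2) * t =
      N (k - 1) ^ (α - 1) * r / 2 - ν * N k ^ 2 * t := by
    rw [sub_mul, h3]
  rw [h4]
  linarith

end Window

/-! ### The truncated unforced systems: the budget is the truncated energy, uniformly in the truncation -/

section Truncated

variable {ν α : ℝ} {N : ℕ → ℝ} {X : ℕ → ℝ → ℝ} {T : ℝ}

/-- The truncated energy `e_M(t) = ½Σ_{j ≤ M} X_j(t)²` of (2.6) ("defining the energy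
`e(t) = ½Σ_k X_k²(t)`"), for a time-dependent amplitude vector `X j t`.
[cite: Palasek2026ElementaryModel, §2 (energy identity (2.6)), p. 7] -/
def truncEnergy (M : ℕ) (X : ℕ → ℝ → ℝ) (t : ℝ) : ℝ :=
  ∑ j ∈ Finset.range (M + 1), 1 / 2 * X j t ^ 2

/-- The truncated energy is non-negative. [cite: Palasek2026ElementaryModel, §2 (2.6)] -/
theorem truncEnergy_nonneg (M : ℕ) (X : ℕ → ℝ → ℝ) (t : ℝ) : 0 ≤ truncEnergy M X t :=
  Finset.sum_nonneg fun j _ => by positivity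

/-- **Energy dissipation of the truncated UNFORCED model**: if the modes `j ≤ M` solve (l2_obukhov) with
`f = 0` within `s` at `t` and the mode `M + 1` is absent at `t`, then `e_M` has derivative
`-Σ_{j ≤ M} νN_j²X_j²` there (the Obukhov pair is energy-neutral: `sum_mul_obukhovRHS_of_truncated`).
[cite: Palasek2026ElementaryModel, §2 (energy identity (2.6)), p. 7] -/
theorem hasDerivWithinAt_truncEnergy {M : ℕ} {s : Set ℝ} {t : ℝ}
    (hode : ∀ j ≤ M, HasDerivWithinAt (X j) (obukhovRHS ν α N (fun i => X i t) 0 j) s t)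
    (htr : X (M + 1) t = 0) :
    HasDerivWithinAt (truncEnergy M X)
      (∑ j ∈ Finset.range (M + 1), -(ν * N j ^ 2 * X j t ^ 2)) s t := by
  have h := hasDerivWithinAt_halfSumSq (ν := ν) (α := α) (N := N) (X := X) (f := fun _ _ => (0 : ℝ))
    (s := s) (t := t) (M := M) hode
  simp only [mul_zero, add_zero, htr] at h
  have hfun : (fun r => ∑ k ∈ Finset.range (M + 1), 1 / 2 * X k r ^ 2) = truncEnergy M X := rfl
  rw [hfun] at h
  convert h using 1
  simp

/-- The truncated dissipation dominates that of any single retained mode: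
`-Σ_{j ≤ M} νN_j²X_j² ≤ -νN_i²X_i²` for `i ≤ M`, `ν ≥ 0`. [cite: Palasek2026ElementaryModel, §2 (2.6)] -/
theorem sum_neg_dissipation_le (hν : 0 ≤ ν) (N : ℕ → ℝ) (Xt : ℕ → ℝ) {M i : ℕ} (hi : i ≤ M) :
    ∑ j ∈ Finset.range (M + 1), -(ν * N j ^ 2 * Xt j ^ 2) ≤ -(ν * N i ^ 2 * Xt i ^ 2) := by
  have hmem : i ∈ Finset.range (M + 1) := Finset.mem_range.2 (Nat.lt_succ_of_le hi)
  have h := Finset.single_le_sum (f := fun j => ν * N j ^ 2 * Xt j ^ 2)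
    (fun j _ => by positivity) hmem
  have hs : ∑ j ∈ Finset.range (M + 1), -(ν * N j ^ 2 * Xt j ^ 2) =
      -∑ j ∈ Finset.range (M + 1), ν * N j ^ 2 * Xt j ^ 2 := Finset.sum_neg_distrib ..
  rw [hs]
  exact neg_le_neg h

/-- **The `λ`-family for the truncated unforced model.** Let the modes `0, …, M` of `X` solve the
UNFORCED viscous model within `[0, T)` with the mode `M + 1` absent (the Galerkin truncation of
(l2_obukhov), cf. Prop. 3.4, here with `f = 0`), `ν > 0`, positive scales. Then every retained mode
`1 ≤ k ≤ M` obeys, for every `λ > 0` and `t ∈ [0, T)`,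
`X_k(t) ≤ max{X_k(0), 0}·exp(λ(e_M(0) - e_M(t)) + (N_{k-1}^{2α-2}/(4λν) - νN_k²)t)` — constants
independent of `M`. [cite: Palasek2026ElementaryModel, §1.3.2 p. 6; §2 (2.6)] -/
theorem truncated_unforced_mode_le_exp (hν : 0 < ν) (hN : ∀ j, 0 < N j) {M k : ℕ} (hk : 1 ≤ k)
    (hkM : k ≤ M)
    (hsol : ∀ j ≤ M, ∀ t ∈ Ico 0 T,
      HasDerivWithinAt (X j) (obukhovRHS ν α N (fun i => X i t) 0 j) (Ico 0 T) t)
    (htr : ∀ t ∈ Ico 0 T, X (M + 1) t = 0) {lam : ℝ} (hlam : 0 < lam) :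
    ∀ t ∈ Ico 0 T, X k t ≤ max (X k 0) 0 *
      Real.exp (lam * (truncEnergy M X 0 - truncEnergy M X t) +
        (N (k - 1) ^ (2 * α - 2) / (4 * lam * ν) - ν * N k ^ 2) * t) :=
  unforced_mode_le_exp hν hN hk (hsol k hkM)
    (fun t ht => hasDerivWithinAt_truncEnergy (fun j hj => hsol j hj t ht) (htr t ht))
    (fun t _ => sum_neg_dissipation_le hν.le N (fun i => X i t) (by omega)) hlam

/-- **Total amplification in the truncated unforced model** is at most
`exp(N_{k-1}^{2α-2}e_M(0)/(4ν²N_k²))`, for every retained mode `1 ≤ k ≤ M`, uniformly in `M`.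
[cite: Palasek2026ElementaryModel, §1.3.2 p. 6; §1.3.1 p. 5] -/
theorem truncated_unforced_mode_amplification_le (hν : 0 < ν) (hN : ∀ j, 0 < N j) {M k : ℕ}
    (hk : 1 ≤ k) (hkM : k ≤ M)
    (hsol : ∀ j ≤ M, ∀ t ∈ Ico 0 T,
      HasDerivWithinAt (X j) (obukhovRHS ν α N (fun i => X i t) 0 j) (Ico 0 T) t)
    (htr : ∀ t ∈ Ico 0 T, X (M + 1) t = 0) :
    ∀ t ∈ Ico 0 T, X k t ≤ max (X k 0) 0 *
      Real.exp (N (k - 1) ^ (2 * α - 2) * truncEnergy M X 0 / (4 * ν ^ 2 * N k ^ 2)) :=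
  unforced_mode_amplification_le hν hN hk (hsol k hkM)
    (fun t ht => hasDerivWithinAt_truncEnergy (fun j hj => hsol j hj t ht) (htr t ht))
    (fun t _ => sum_neg_dissipation_le hν.le N (fun i => X i t) (by omega))
    (fun t _ => truncEnergy_nonneg M X t)

/-- **The dissipation window in the truncated unforced model**: for every retained mode `1 ≤ k ≤ M` and
every `t ∈ [0, T)` with `t ≥ N_{k-1}^{2α-2}e_M(0)/(ν³N_k⁴)`, `X_k(t) ≤ max{X_k(0), 0}` — no net growth
after the window, uniformly in `M`. [cite: Palasek2026ElementaryModel, §1.3.2 p. 6 ("growth is obstructed")] -/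
theorem truncated_unforced_mode_le_of_window_le (hν : 0 < ν) (hN : ∀ j, 0 < N j) {M k : ℕ}
    (hk : 1 ≤ k) (hkM : k ≤ M)
    (hsol : ∀ j ≤ M, ∀ t ∈ Ico 0 T,
      HasDerivWithinAt (X j) (obukhovRHS ν α N (fun i => X i t) 0 j) (Ico 0 T) t)
    (htr : ∀ t ∈ Ico 0 T, X (M + 1) t = 0) {t : ℝ} (ht : t ∈ Ico 0 T)
    (hwin : N (k - 1) ^ (2 * α - 2) * truncEnergy M X 0 / (ν ^ 3 * N k ^ 4) ≤ t) :
    X k t ≤ max (X k 0) 0 :=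
  unforced_mode_le_of_window_le hν hN hk (hsol k hkM)
    (fun t ht => hasDerivWithinAt_truncEnergy (fun j hj => hsol j hj t ht) (htr t ht))
    (fun t _ => sum_neg_dissipation_le hν.le N (fun i => X i t) (by omega))
    (fun t _ => truncEnergy_nonneg M X t) ht hwin

end Truncated

/-! ### "when `α < 3`": the window along increasing / super-lacunary scales -/

section Scales

/-- **For increasing scales the window is at most `N_{k-1}^{2α-6}e₀/ν³`**: if `0 < N_{k-1} ≤ N_k` then
`N_{k-1}^{2α-2}e₀/(ν³N_k⁴) ≤ N_{k-1}^{2α-6}e₀/ν³` (`e₀ ≥ 0`, `ν > 0`) — only the monotonicity of the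
scales is used, as in the printed "so growth is obstructed when `α < 3`".
[cite: Palasek2026ElementaryModel, §1.3.2 p. 6] -/
theorem window_le_rpow_of_le {ν n n' e₀ α : ℝ} (hν : 0 < ν) (hn : 0 < n) (hnn' : n ≤ n')
    (he : 0 ≤ e₀) :
    n ^ (2 * α - 2) * e₀ / (ν ^ 3 * n' ^ 4) ≤ n ^ (2 * α - 6) * e₀ / ν ^ 3 := by
  have hn' : 0 < n' := hn.trans_le hnn'
  have hpow : n ^ (2 * α - 6) = n ^ (2 * α - 2) / n ^ 4 := by
    rw [show (2 : ℝ) * α - 6 = (2 * α - 2) - 4 by ring, Real.rpow_sub hn]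
    norm_num
  have h4 : n ^ 4 ≤ n' ^ 4 := by gcongr
  rw [hpow]
  have hP : 0 ≤ n ^ (2 * α - 2) * e₀ := mul_nonneg (Real.rpow_nonneg hn.le _) he
  rw [div_mul_eq_mul_div, div_div, show ν ^ 3 * n' ^ 4 = n' ^ 4 * ν ^ 3 by ring]
  exact div_le_div_of_nonneg_left hP (by positivity) (by gcongr)

/-- **In Palasek's scales `N_k = N₀^{b^k}` (`N₀ > 1`, `b > 1`) every negative power tends to zero along
the levels**; with `γ = 2α - 6 < 0`, i.e. `α < 3`, the dissipation windows `N_{k-1}^{2α-6}e₀/ν³` of the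
data-seeded levels shrink to zero — "growth is obstructed when `α < 3`".
[cite: Palasek2026ElementaryModel, §1.3.2 p. 6; §1.2 (nk_choice)] -/
theorem tendsto_scale_rpow_atTop_nhds_zero {N₀ b γ : ℝ} (hN₀ : 1 < N₀) (hb : 1 < b) (hγ : γ < 0) :
    Tendsto (fun k : ℕ => scale N₀ b k ^ γ) atTop (𝓝 0) := by
  have hN₀' : 0 < N₀ := by linarith
  have hfun : (fun k : ℕ => scale N₀ b k ^ γ) = fun k => Real.exp (γ * (b ^ k * Real.log N₀)) := by
    funext k
    rw [scale_eq_exp hN₀' b k, ← Real.exp_mul, mul_comm]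
  rw [hfun]
  exact Real.tendsto_exp_atBot.comp
    ((tendsto_log_scale_atTop hN₀ hb).const_mul_atTop_of_neg hγ)

/-- **The window of level `k` in Palasek's scales, and its limit.** For `N_k = N₀^{b^k}`, `N₀ > 1`,
`b > 1`, `ν > 0`, `e₀ ≥ 0`: `N_{k-1}^{2α-2}e₀/(ν³N_k⁴) ≤ N_{k-1}^{2α-6}e₀/ν³`, and for `α < 3` the
right-hand side tends to `0` as `k → ∞`. (So an unforced level `k` seeded in the datum makes no net
growth after time `N_{k-1}^{2α-6}e₀/ν³ → 0` — `truncated_unforced_mode_le_of_window_le` — whereas the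
cascade of §1.3.1 needs level `k` to grow during the LATER interval `I_{k-1}`; this is the printed
reason for the force of Theorem 1.3, which switches the dissipation of level `k` off before `t_k`:
`IsTowerSolution.hasDeriv_forced`.) [cite: Palasek2026ElementaryModel, §1.3.2 p. 6; Rem. 1.4 p. 4] -/
theorem scale_window_le_and_tendsto {N₀ b ν α e₀ : ℝ} (hN₀ : 1 < N₀) (hb : 1 < b) (hν : 0 < ν)
    (he : 0 ≤ e₀) (hα : α < 3) :
    (∀ k : ℕ, 1 ≤ k →
      scale N₀ b (k - 1) ^ (2 * α - 2) * e₀ / (ν ^ 3 * scale N₀ b k ^ 4) ≤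
        scale N₀ b (k - 1) ^ (2 * α - 6) * e₀ / ν ^ 3) ∧
    Tendsto (fun k : ℕ => scale N₀ b (k - 1) ^ (2 * α - 6) * e₀ / ν ^ 3) atTop (𝓝 0) := by
  have hN₀' : 0 < N₀ := by linarith
  refine ⟨fun k hk => ?_, ?_⟩
  · refine window_le_rpow_of_le hν (scale_pos hN₀' b (k - 1)) ?_ he
    have hk' : k = (k - 1) + 1 := by omega
    rw [hk']
    simpa using (scale_lt_scale_succ hN₀ hb (k - 1)).le
  · have h0 := tendsto_scale_rpow_atTop_nhds_zero hN₀ hb (show 2 * α - 6 < 0 by linarith)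
    have h1 : Tendsto (fun k : ℕ => scale N₀ b (k - 1) ^ (2 * α - 6)) atTop (𝓝 0) :=
      h0.comp (tendsto_sub_atTop_nat 1)
    simpa using (h1.mul_const e₀).div_const (ν ^ 3)

/-- **Amplification exponent in Palasek's scales**: `N_{k-1}^{2α-2}e₀/(4ν²N_k²) = N_{k-1}^{2(α-1-b)}e₀/(4ν²)`
(`N_k = N_{k-1}^b`); it tends to zero along the levels when `b > α - 1` — NOT the printed range
`b < α/2` once `α > 2` (there the amplification bound is void and the operative statement is the
WINDOW above); recorded for the geometric intuition "norm inflation" of §1.3.1 only.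
[cite: Palasek2026ElementaryModel, §1.3.1 p. 5; §1.2 (nk_choice)] -/
theorem scale_amplificationExponent_eq {N₀ b ν α e₀ : ℝ} (hN₀ : 1 < N₀) (k : ℕ) :
    scale N₀ b k ^ (2 * α - 2) * e₀ / (4 * ν ^ 2 * scale N₀ b (k + 1) ^ 2) =
      scale N₀ b k ^ (2 * (α - 1 - b)) * e₀ / (4 * ν ^ 2) := by
  have hN₀' : 0 < N₀ := by linarith
  have hs : 0 < scale N₀ b k := scale_pos hN₀' b k
  have h2 : scale N₀ b (k + 1) ^ 2 = scale N₀ b k ^ (2 * b) := by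
    rw [scale_succ hN₀'.le b k, ← Real.rpow_natCast (scale N₀ b k ^ b) 2, ← Real.rpow_mul hs.le]
    congr 1
    push_cast
    ring
  have h3 : scale N₀ b k ^ (2 * (α - 1 - b)) = scale N₀ b k ^ (2 * α - 2) / scale N₀ b k ^ (2 * b) := by
    rw [← Real.rpow_sub hs]
    congr 1
    ring
  rw [h2, h3]
  field_simp

end Scales

end PalasekObukhov

end Literature.Analysis.FluidPDE

end
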